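import Summits.HubbardSuperconductivity.HubbardSuperconductivity.Theorems.AnisotropyChordInsertionEntropyInfrared
import Literature.Probability.LatticeModels.TorusMomentumSumBound
import Literature.Probability.LatticeModels.TorusMomentumLatticeSums
import Mathlib.Analysis.Convex.SpecificFunctions.Basic

/-!
# Route `AnisotropyChord` / H0 rotor rung: the entropy route — THE LATTICE SUM
# `Σ_{k ≠ 0} |k|_T^{−α} ≤ C(α) L²` on `(ℤ/L)²` for `α < 2`

The dimension count of the theory seat's reduction `EntropyRouteReduction` (memo ROTOR-THEORY-7 §93):
«`(IR_α)` with `|Λ|⁻¹ Σ_{k≠0} |k|_T^{−α} ≤ C(α) < ∞` (`α < 2`, `d = 2`)» — the discrete form of the local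
integrability of `|k|^{−α}` in two dimensions.  Here `|k|_T = torusNorm L k = (2π/L)·‖m(k)‖₂` with
`mᵢ(k) = min(kᵢ, L − kᵢ) = |valMinAbs kᵢ|` the torus distance.

* `sum_Icc_rpow_neg_le` — `Σ_{j=1}^{n} j^{−β} ≤ n^{1−β}/(1−β)` for `β ∈ [0,1)` (Bernoulli + telescoping);
* `torusNorm_eq`, `torusNorm_pos`, `torusNorm_le` — `|k|_T = (2π/L)√(m₁²+m₂²)`, `> 0` for `k ≠ 0`,
  `≤ π√2`;
* `rpow_neg_torusNorm_le_prod` — the AM–GM split `|k|_T^{−α} ≤ (L/2π)^α h(m₁) h(m₂)`,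
  `h(m) = max(m,1)^{−α/2}` (`α ≥ 0`), which factorises the two-dimensional sum;
* **`sum_rpow_neg_torusNorm_le`** (`0 ≤ α < 2`, explicit constant) and
  **`exists_sum_rpow_neg_torusNorm_le`** (every `α < 2`): `Σ_{k ≠ 0} |k|_T^{−α} ≤ C · L²`.
-/

set_option linter.dupNamespace false

noncomputable section

open Finset Filter Topology
open scoped Real
open Literature.MathematicalPhysics.QuantumLattice Literature.Probability.LatticeModels

namespace Summit.HubbardSuperconductivity.HubbardSuperconductivity.Theorems.AnisotropyChord.InsertionEntropy

/-! ## The one-dimensional power sum -/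

/-- **Bernoulli step:** for `m ≥ 1` and `p ∈ [0,1]`, `(m − 1)^p ≤ m^p − p · m^{p−1}`. [folklore] -/
theorem rpow_sub_one_le {m : ℝ} (hm : 1 ≤ m) {p : ℝ} (hp0 : 0 ≤ p) (hp1 : p ≤ 1) :
    (m - 1) ^ p ≤ m ^ p - p * m ^ (p - 1) := by
  have hm0 : 0 < m := lt_of_lt_of_le one_pos hm
  have hs : (-1 : ℝ) ≤ -1 / m := by
    rw [neg_div, neg_le_neg_iff]
    exact (div_le_one hm0).mpr hm
  have hB := rpow_one_add_le_one_add_mul_self hs hp0 hp1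
  -- multiply by `m^p`
  have h1 : (1 + -1 / m) ^ p * m ^ p = (m - 1) ^ p := by
    have hnn : (0 : ℝ) ≤ 1 + -1 / m := by
      have : 1 / m ≤ 1 := (div_le_one hm0).mpr hm
      have e : 1 + -1 / m = 1 - 1 / m := by ring
      rw [e]; linarith
    rw [← Real.mul_rpow hnn hm0.le]
    congr 1
    field_simp
    ring
  have h2 : (1 + p * (-1 / m)) * m ^ p = m ^ p - p * m ^ (p - 1) := by
    rw [Real.rpow_sub_one hm0.ne']
    field_simp
    ring
  calc (m - 1) ^ p = (1 + -1 / m) ^ p * m ^ p := h1.symm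
    _ ≤ (1 + p * (-1 / m)) * m ^ p :=
        mul_le_mul_of_nonneg_right hB (Real.rpow_nonneg hm0.le _)
    _ = m ^ p - p * m ^ (p - 1) := h2

/-- **The one-dimensional power sum:** `Σ_{j=1}^{n} j^{−β} ≤ n^{1−β}/(1 − β)` for `β ∈ [0,1)`
(each term is at most the increment of `x^{1−β}/(1−β)` over `[j−1, j]`). [folklore] -/
theorem sum_Icc_rpow_neg_le {β : ℝ} (hβ0 : 0 ≤ β) (hβ1 : β < 1) (n : ℕ) :
    ∑ j ∈ Finset.Icc 1 n, ((j : ℕ) : ℝ) ^ (-β) ≤ (n : ℝ) ^ (1 - β) / (1 - β) := by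
  have h1β : 0 < 1 - β := sub_pos.mpr hβ1
  induction n with
  | zero =>
      simp [Real.zero_rpow h1β.ne']
  | succ n ih =>
      rw [Finset.sum_Icc_succ_top (by omega), Nat.cast_succ]
      have hm : (1 : ℝ) ≤ (n : ℝ) + 1 := by
        have : (0 : ℝ) ≤ (n : ℝ) := Nat.cast_nonneg n
        linarith
      have hstep := rpow_sub_one_le hm h1β.le (by linarith)
      rw [add_sub_cancel_right, show (1 - β - 1 : ℝ) = -β by ring] at hstep
      -- `n^{1-β} ≤ (n+1)^{1-β} − (1−β)(n+1)^{−β}`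
      have key : ((n : ℝ) + 1) ^ (-β) ≤ (((n : ℝ) + 1) ^ (1 - β) - (n : ℝ) ^ (1 - β)) / (1 - β) := by
        rw [le_div_iff₀ h1β]
        linarith
      calc ∑ j ∈ Finset.Icc 1 n, ((j : ℕ) : ℝ) ^ (-β) + ((n : ℝ) + 1) ^ (-β)
          ≤ (n : ℝ) ^ (1 - β) / (1 - β) + (((n : ℝ) + 1) ^ (1 - β) - (n : ℝ) ^ (1 - β)) / (1 - β) :=
            add_le_add ih key
        _ = ((n : ℝ) + 1) ^ (1 - β) / (1 - β) := by ring

/-! ## The torus norm in terms of the torus distance -/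

variable {L : ℕ} [NeZero L]

/-- `|k|_T = (2π/L) · √(Σᵢ |valMinAbs kᵢ|²)`. [folklore] -/
theorem torusNorm_eq (k : TorusSite 2 L) :
    torusNorm L k = 2 * π / (L : ℝ) * Real.sqrt (∑ i, (((k i).valMinAbs.natAbs : ℕ) : ℝ) ^ 2) := by
  unfold torusNorm
  simp_rw [ZMod.valMinAbs_natAbs_eq_min]

/-- The squared torus distance of a nonzero momentum is at least one. [folklore] -/
theorem one_le_sum_natAbs_valMinAbs_sq {k : TorusSite 2 L} (hk : k ≠ 0) :
    (1 : ℝ) ≤ ∑ i, (((k i).valMinAbs.natAbs : ℕ) : ℝ) ^ 2 := by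
  have h := one_le_sum_valMinAbs_sq hk
  simp_rw [← natAbs_valMinAbs_sq_eq] at h
  exact h

/-- `|k|_T > 0` for `k ≠ 0`. [folklore] -/
theorem torusNorm_pos {k : TorusSite 2 L} (hk : k ≠ 0) : 0 < torusNorm L k := by
  rw [torusNorm_eq]
  have hL : (0 : ℝ) < (L : ℝ) := by exact_mod_cast Nat.pos_of_ne_zero (NeZero.ne L)
  have h1 := one_le_sum_natAbs_valMinAbs_sq hk
  have : 0 < Real.sqrt (∑ i, (((k i).valMinAbs.natAbs : ℕ) : ℝ) ^ 2) :=
    Real.sqrt_pos.mpr (lt_of_lt_of_le one_pos h1)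
  positivity

/-- `|k|_T ≥ 0`. [folklore] -/
theorem torusNorm_nonneg (k : TorusSite 2 L) : 0 ≤ torusNorm L k := by
  rw [torusNorm_eq]; positivity

/-- The torus distance of one coordinate is at most `L/2`. [folklore] -/
theorem natAbs_valMinAbs_le_half (a : ZMod L) : ((a.valMinAbs.natAbs : ℕ) : ℝ) ≤ (L : ℝ) / 2 := by
  have h := ZMod.natAbs_valMinAbs_le a
  have h2 : ((a.valMinAbs.natAbs : ℕ) : ℝ) ≤ ((L / 2 : ℕ) : ℝ) := by exact_mod_cast h
  exact h2.trans (Nat.cast_div_le)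

/-- `|k|_T ≤ π√2` (each reduced coordinate is at most `L/2`). [folklore] -/
theorem torusNorm_le (k : TorusSite 2 L) : torusNorm L k ≤ π * Real.sqrt 2 := by
  rw [torusNorm_eq]
  have hL : (0 : ℝ) < (L : ℝ) := by exact_mod_cast Nat.pos_of_ne_zero (NeZero.ne L)
  have hsum : ∑ i, (((k i).valMinAbs.natAbs : ℕ) : ℝ) ^ 2 ≤ ((L : ℝ) / 2) ^ 2 * 2 := by
    calc ∑ i, (((k i).valMinAbs.natAbs : ℕ) : ℝ) ^ 2 ≤ ∑ _i : Fin 2, ((L : ℝ) / 2) ^ 2 := by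
          refine Finset.sum_le_sum fun i _ => ?_
          exact pow_le_pow_left₀ (Nat.cast_nonneg _) (natAbs_valMinAbs_le_half (k i)) 2
      _ = ((L : ℝ) / 2) ^ 2 * 2 := by rw [Finset.sum_const, Finset.card_univ, Fintype.card_fin]; ring
  have hsq : Real.sqrt (∑ i, (((k i).valMinAbs.natAbs : ℕ) : ℝ) ^ 2) ≤ (L : ℝ) / 2 * Real.sqrt 2 := by
    calc Real.sqrt (∑ i, (((k i).valMinAbs.natAbs : ℕ) : ℝ) ^ 2)
        ≤ Real.sqrt (((L : ℝ) / 2) ^ 2 * 2) := Real.sqrt_le_sqrt hsum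
      _ = (L : ℝ) / 2 * Real.sqrt 2 := by
          rw [Real.sqrt_mul (sq_nonneg _), Real.sqrt_sq (by positivity)]
  calc 2 * π / (L : ℝ) * Real.sqrt (∑ i, (((k i).valMinAbs.natAbs : ℕ) : ℝ) ^ 2)
      ≤ 2 * π / (L : ℝ) * ((L : ℝ) / 2 * Real.sqrt 2) :=
        mul_le_mul_of_nonneg_left hsq (by positivity)
    _ = π * Real.sqrt 2 := by field_simp

/-! ## The AM–GM split of `|k|_T^{-α}` -/

/-- For naturals not both zero, `max(m₁,1) · max(m₂,1) ≤ m₁² + m₂²`. [folklore] -/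
theorem max_one_mul_max_one_le_sq_add_sq {m₁ m₂ : ℕ} (h : m₁ ≠ 0 ∨ m₂ ≠ 0) :
    ((max m₁ 1 : ℕ) : ℝ) * ((max m₂ 1 : ℕ) : ℝ) ≤ (m₁ : ℝ) ^ 2 + (m₂ : ℝ) ^ 2 := by
  have key : (max m₁ 1) * (max m₂ 1) ≤ m₁ ^ 2 + m₂ ^ 2 := by
    rcases Nat.eq_zero_or_pos m₁ with h1 | h1 <;> rcases Nat.eq_zero_or_pos m₂ with h2 | h2
    · omega
    · subst h1; rw [Nat.max_eq_right (by omega), Nat.max_eq_left h2]; nlinarith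
    · subst h2; rw [Nat.max_eq_left h1, Nat.max_eq_right (by omega)]; nlinarith
    · rw [Nat.max_eq_left h1, Nat.max_eq_left h2]; nlinarith
  exact_mod_cast key

/-- **AM–GM split:** for `α ≥ 0` and `k ≠ 0`,
`|k|_T^{−α} ≤ (L/(2π))^α · max(m₁,1)^{−α/2} · max(m₂,1)^{−α/2}`, `mᵢ = |valMinAbs kᵢ|`. [folklore] -/
theorem rpow_neg_torusNorm_le_prod {α : ℝ} (hα : 0 ≤ α) {k : TorusSite 2 L} (hk : k ≠ 0) :
    (torusNorm L k) ^ (-α)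
      ≤ ((L : ℝ) / (2 * π)) ^ α *
        ∏ i, ((max (k i).valMinAbs.natAbs 1 : ℕ) : ℝ) ^ (-(α / 2)) := by
  have hL : (0 : ℝ) < (L : ℝ) := by exact_mod_cast Nat.pos_of_ne_zero (NeZero.ne L)
  set q : ℝ := ∑ i, (((k i).valMinAbs.natAbs : ℕ) : ℝ) ^ 2 with hq
  have hq1 : 1 ≤ q := one_le_sum_natAbs_valMinAbs_sq hk
  have hq0 : 0 < q := lt_of_lt_of_le one_pos hq1
  -- `|k|_T^{-α} = (L/2π)^α · q^{-α/2}`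
  have h1 : (torusNorm L k) ^ (-α) = ((L : ℝ) / (2 * π)) ^ α * q ^ (-(α / 2)) := by
    rw [torusNorm_eq, ← hq, Real.mul_rpow (by positivity) (Real.sqrt_nonneg _),
      Real.sqrt_eq_rpow, ← Real.rpow_mul hq0.le]
    congr 1
    · rw [Real.rpow_neg (by positivity), ← Real.inv_rpow (by positivity), inv_div]
    · congr 1; ring
  rw [h1]
  refine mul_le_mul_of_nonneg_left ?_ (Real.rpow_nonneg (by positivity) _)
  -- `q^{-α/2} ≤ (max(m₁,1) max(m₂,1))^{-α/2} = Π h(mᵢ)`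
  have hne : (k 0).valMinAbs.natAbs ≠ 0 ∨ (k 1).valMinAbs.natAbs ≠ 0 := by
    by_contra hcon
    push Not at hcon
    apply hk
    funext i
    fin_cases i
    · exact (ZMod.valMinAbs_eq_zero _).mp (Int.natAbs_eq_zero.mp hcon.1)
    · exact (ZMod.valMinAbs_eq_zero _).mp (Int.natAbs_eq_zero.mp hcon.2)
  have hprod_le : ((max (k 0).valMinAbs.natAbs 1 : ℕ) : ℝ) * ((max (k 1).valMinAbs.natAbs 1 : ℕ) : ℝ) ≤ q := by
    rw [hq, Fin.sum_univ_two]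
    exact max_one_mul_max_one_le_sq_add_sq hne
  have hprod_pos : 0 < ((max (k 0).valMinAbs.natAbs 1 : ℕ) : ℝ) * ((max (k 1).valMinAbs.natAbs 1 : ℕ) : ℝ) := by
    have h0 : (0 : ℝ) < ((max (k 0).valMinAbs.natAbs 1 : ℕ) : ℝ) := by
      exact_mod_cast lt_of_lt_of_le one_pos (le_max_right _ _)
    have h1' : (0 : ℝ) < ((max (k 1).valMinAbs.natAbs 1 : ℕ) : ℝ) := by
      exact_mod_cast lt_of_lt_of_le one_pos (le_max_right _ _)
    positivity
  rw [Fin.prod_univ_two, ← Real.mul_rpow (Nat.cast_nonneg _) (Nat.cast_nonneg _)]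
  exact Real.rpow_le_rpow_of_nonpos hprod_pos hprod_le (by linarith)

/-! ## The two-dimensional sum -/

/-- **The folded one-dimensional factor:** `Σ_{a ∈ ℤ/L} max(|a|,1)^{−β} ≤ (1 + 2/(1−β)) · L^{1−β}` for
`β ∈ [0,1)`. [folklore] -/
theorem sum_zmod_rpow_neg_le {β : ℝ} (hβ0 : 0 ≤ β) (hβ1 : β < 1) :
    ∑ a : ZMod L, ((max a.valMinAbs.natAbs 1 : ℕ) : ℝ) ^ (-β) ≤ (1 + 2 / (1 - β)) * (L : ℝ) ^ (1 - β) := by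
  have h1β : 0 < 1 - β := sub_pos.mpr hβ1
  have hL1 : (1 : ℝ) ≤ (L : ℝ) := by exact_mod_cast Nat.one_le_iff_ne_zero.mpr (NeZero.ne L)
  have hfold := sum_zmod_le_of_valMinAbs L (fun j => ((max j 1 : ℕ) : ℝ) ^ (-β))
    (fun j => Real.rpow_nonneg (Nat.cast_nonneg _) _)
  have h0 : ((max 0 1 : ℕ) : ℝ) ^ (-β) = 1 := by simp
  have hIcc : ∑ j ∈ Finset.Icc 1 (L / 2), ((max j 1 : ℕ) : ℝ) ^ (-β)
      = ∑ j ∈ Finset.Icc 1 (L / 2), ((j : ℕ) : ℝ) ^ (-β) := by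
    refine Finset.sum_congr rfl fun j hj => ?_
    rw [Finset.mem_Icc] at hj
    rw [Nat.max_eq_left hj.1]
  rw [h0, hIcc] at hfold
  have hpow := sum_Icc_rpow_neg_le hβ0 hβ1 (L / 2)
  have hhalf : ((L / 2 : ℕ) : ℝ) ^ (1 - β) ≤ (L : ℝ) ^ (1 - β) :=
    Real.rpow_le_rpow (Nat.cast_nonneg _) (by exact_mod_cast Nat.div_le_self L 2) h1β.le
  have hLpow : (1 : ℝ) ≤ (L : ℝ) ^ (1 - β) := Real.one_le_rpow hL1 h1β.le
  calc ∑ a : ZMod L, ((max a.valMinAbs.natAbs 1 : ℕ) : ℝ) ^ (-β)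
      ≤ 1 + 2 * ∑ j ∈ Finset.Icc 1 (L / 2), ((j : ℕ) : ℝ) ^ (-β) := hfold
    _ ≤ 1 + 2 * ((L : ℝ) ^ (1 - β) / (1 - β)) := by
        have := hpow.trans (div_le_div_of_nonneg_right hhalf h1β.le)
        linarith
    _ ≤ (L : ℝ) ^ (1 - β) + 2 * ((L : ℝ) ^ (1 - β) / (1 - β)) := by linarith
    _ = (1 + 2 / (1 - β)) * (L : ℝ) ^ (1 - β) := by ring

/-- **THE LATTICE SUM (`0 ≤ α < 2`, explicit constant):**
`Σ_{k ≠ 0} |k|_T^{−α} ≤ (2π)^{−α} (1 + 2/(1 − α/2))² · L²` on `(ℤ/L)²`. [folklore] -/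
theorem sum_rpow_neg_torusNorm_le {α : ℝ} (hα0 : 0 ≤ α) (hα2 : α < 2) :
    ∑ k ∈ Finset.univ.filter (fun k : TorusSite 2 L => k ≠ 0), (torusNorm L k) ^ (-α)
      ≤ (2 * π) ^ (-α) * (1 + 2 / (1 - α / 2)) ^ 2 * (L : ℝ) ^ 2 := by
  have hL : (0 : ℝ) < (L : ℝ) := by exact_mod_cast Nat.pos_of_ne_zero (NeZero.ne L)
  have hβ0 : 0 ≤ α / 2 := by linarith
  have hβ1 : α / 2 < 1 := by linarith
  set h : ℕ → ℝ := fun m => ((max m 1 : ℕ) : ℝ) ^ (-(α / 2)) with hh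
  have hh0 : ∀ m, 0 ≤ h m := fun m => Real.rpow_nonneg (Nat.cast_nonneg _) _
  -- pointwise split, then drop the constraint `k ≠ 0`
  have step1 : ∑ k ∈ Finset.univ.filter (fun k : TorusSite 2 L => k ≠ 0), (torusNorm L k) ^ (-α)
      ≤ ∑ k : TorusSite 2 L, ((L : ℝ) / (2 * π)) ^ α * ∏ i, h ((k i).valMinAbs.natAbs) := by
    calc ∑ k ∈ Finset.univ.filter (fun k : TorusSite 2 L => k ≠ 0), (torusNorm L k) ^ (-α)
        ≤ ∑ k ∈ Finset.univ.filter (fun k : TorusSite 2 L => k ≠ 0),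
            ((L : ℝ) / (2 * π)) ^ α * ∏ i, h ((k i).valMinAbs.natAbs) := by
          refine Finset.sum_le_sum fun k hk => ?_
          rw [Finset.mem_filter] at hk
          exact rpow_neg_torusNorm_le_prod hα0 hk.2
      _ ≤ ∑ k : TorusSite 2 L, ((L : ℝ) / (2 * π)) ^ α * ∏ i, h ((k i).valMinAbs.natAbs) :=
          Finset.sum_le_sum_of_subset_of_nonneg (Finset.filter_subset _ _) fun k _ _ =>
            mul_nonneg (Real.rpow_nonneg (by positivity) _) (Finset.prod_nonneg fun i _ => hh0 _)
  -- factorise the free sum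
  have step2 : ∑ k : TorusSite 2 L, ((L : ℝ) / (2 * π)) ^ α * ∏ i, h ((k i).valMinAbs.natAbs)
      = ((L : ℝ) / (2 * π)) ^ α * (∑ a : ZMod L, h a.valMinAbs.natAbs) ^ 2 := by
    rw [← Finset.mul_sum]
    congr 1
    have hf : ∑ k : TorusSite 2 L, ∏ i, h ((k i).valMinAbs.natAbs)
        = ∏ _i : Fin 2, ∑ a : ZMod L, h a.valMinAbs.natAbs := by
      rw [Finset.prod_univ_sum]
      simp [Fintype.piFinset_univ]
    rw [hf, Finset.prod_const, Finset.card_univ, Fintype.card_fin]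
  have step3 := sum_zmod_rpow_neg_le (L := L) hβ0 hβ1
  have hS0 : 0 ≤ ∑ a : ZMod L, h a.valMinAbs.natAbs := Finset.sum_nonneg fun a _ => hh0 _
  -- assemble
  have hpow : ((L : ℝ) / (2 * π)) ^ α * ((1 + 2 / (1 - α / 2)) * (L : ℝ) ^ (1 - α / 2)) ^ 2
      = (2 * π) ^ (-α) * (1 + 2 / (1 - α / 2)) ^ 2 * (L : ℝ) ^ 2 := by
    rw [Real.div_rpow hL.le (by positivity), mul_pow, ← Real.rpow_natCast ((L : ℝ) ^ (1 - α / 2)) 2,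
      ← Real.rpow_mul hL.le, Real.rpow_neg (by positivity)]
    have e : (L : ℝ) ^ α * (L : ℝ) ^ ((1 - α / 2) * (2 : ℕ)) = (L : ℝ) ^ 2 := by
      rw [← Real.rpow_add hL, ← Real.rpow_natCast (L : ℝ) 2]
      congr 1; push_cast; ring
    rw [← e]
    ring
  calc ∑ k ∈ Finset.univ.filter (fun k : TorusSite 2 L => k ≠ 0), (torusNorm L k) ^ (-α)
      ≤ ((L : ℝ) / (2 * π)) ^ α * (∑ a : ZMod L, h a.valMinAbs.natAbs) ^ 2 := by rw [← step2]; exact step1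
    _ ≤ ((L : ℝ) / (2 * π)) ^ α * ((1 + 2 / (1 - α / 2)) * (L : ℝ) ^ (1 - α / 2)) ^ 2 := by
        refine mul_le_mul_of_nonneg_left ?_ (Real.rpow_nonneg (by positivity) _)
        exact pow_le_pow_left₀ hS0 step3 2
    _ = (2 * π) ^ (-α) * (1 + 2 / (1 - α / 2)) ^ 2 * (L : ℝ) ^ 2 := hpow

/-- **THE LATTICE SUM for every `α < 2`:** there is `C ≥ 0` with `Σ_{k ≠ 0} |k|_T^{−α} ≤ C · L²` on every
torus `(ℤ/L)²` (for `α < 0` use `|k|_T ≤ π√2`). [folklore] -/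
theorem exists_sum_rpow_neg_torusNorm_le {α : ℝ} (hα2 : α < 2) :
    ∃ C : ℝ, 0 ≤ C ∧ ∀ (L : ℕ) [NeZero L],
      ∑ k ∈ Finset.univ.filter (fun k : TorusSite 2 L => k ≠ 0), (torusNorm L k) ^ (-α) ≤ C * (L : ℝ) ^ 2 := by
  by_cases hα0 : 0 ≤ α
  · refine ⟨(2 * π) ^ (-α) * (1 + 2 / (1 - α / 2)) ^ 2, by positivity, fun L _ => ?_⟩
    exact sum_rpow_neg_torusNorm_le hα0 hα2
  · push Not at hα0
    refine ⟨(π * Real.sqrt 2) ^ (-α), by positivity, fun L _ => ?_⟩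
    have hcard : (Fintype.card (TorusSite 2 L) : ℝ) = (L : ℝ) ^ 2 := by
      rw [Fintype.card_fun, ZMod.card, Fintype.card_fin]; push_cast; ring
    calc ∑ k ∈ Finset.univ.filter (fun k : TorusSite 2 L => k ≠ 0), (torusNorm L k) ^ (-α)
        ≤ ∑ k ∈ Finset.univ.filter (fun k : TorusSite 2 L => k ≠ 0), (π * Real.sqrt 2) ^ (-α) := by
          refine Finset.sum_le_sum fun k _ => ?_
          exact Real.rpow_le_rpow (torusNorm_nonneg k) (torusNorm_le k) (by linarith)
      _ ≤ ∑ _k : TorusSite 2 L, (π * Real.sqrt 2) ^ (-α) :=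
          Finset.sum_le_sum_of_subset_of_nonneg (Finset.filter_subset _ _) fun k _ _ =>
            Real.rpow_nonneg (by positivity) _
      _ = (π * Real.sqrt 2) ^ (-α) * (L : ℝ) ^ 2 := by
          rw [Finset.sum_const, Finset.card_univ, nsmul_eq_mul, hcard, mul_comm]

end Summit.HubbardSuperconductivity.HubbardSuperconductivity.Theorems.AnisotropyChord.InsertionEntropy
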